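import Literature.AlgebraicGeometry.AbelianSchemes.TupleIsoSpecialInjectivityOfGeneric     -- ★ (GS-3), ★ (R2) rebase, `Limits` diagonal lemmas
import Literature.AlgebraicGeometry.LaurentSchroer2023.ParaAbelianGroupLaw                  -- ★ `nonempty_algPoints_of_isAlgClosed` (Nullstellensatz)
import HarnessLib

/-!
# (GENERIC INJECTIVITY) of ★ (GS-3) from ONE algebraically closed field over the generic point (organ (GS-3c′) of the `stub_INJ0` payer)

Topic `AlgebraicGeometry/AbelianSchemes` (with a pure `Limits` lemma in §1); namespaces `Literature.AlgebraicGeometry.Limits` (§1) and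
`Literature.AlgebraicGeometry.AbelianSchemes.AbelianSchemeOver` (§2), as in ★ `TupleIsoSpecialInjectivityOfGeneric`.  THEOREMS ONLY (no definition, no instance,
no notation, no named fact, no `sorry`); universe-polymorphic.  Cell `hodgecm-mathlib` (D-0151), P6 «MOD programme» (crux hLiu418 = stmt-HodgeConjecture-24832,
`--supports`, count-neutral); P-LINE ED. 2 leaf `Lines/F0_P6a_PELSpread.lean`, socket `stub_INJ0` (LEAD F0P6-plan (g3) «M-55»; memo `MEMO-INJ0-CUT-stagefamily.v1`
§1).  HC_CM is proved only modulo the printed citations until rung 0 closes; nothing here is about HC.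

THE MATHEMATICS ([MumfordFogartyKirwan1994] Ch. 7 §2 Prop. 7.3; [GortzWedhorn2020] Prop. 3.35 ∕ Cor. 3.36).  ★ (GS-3) `exists_finset_forall_eq_of_tupleIsoAt` asks
GENERIC INJECTIVITY at the geometric points over the generic point valued in EVERY algebraically closed field `Ω`, while the E-side separation of the P6a
line (`ESepAt`) is read in ONE field `Ω₀ = Ω̄_w` per place.  The two are equivalent given the `Isom`-PIECES (`hpieces`): if injectivity failed at some
`Ω`-point over the generic point, the pair point would lie in a finite-type piece `I_i` minus the diagonal, over the generic point `η`; the fibre of that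
piece over `Spec Ω₀ → η` is then a NON-EMPTY scheme locally of finite type over the algebraically closed `Ω₀`, so it has an `Ω₀`-point (Nullstellensatz,
★ `nonempty_algPoints_of_isAlgClosed`) — an `Ω₀`-valued failure of injectivity, excluded by hypothesis.

* `Limits.forall_not_of_pieces_of_algClosed` — §1, pure: for a property `Φ` of geometric points of `W → Spec B` cut out by finitely many finite-type pieces,
  «`¬ Φ` at the `Ω₀`-points over `ι₀ : B → Ω₀`» ⇒ «`¬ Φ` at every geometric point with the same image in `Spec B`».
* `forall_eq_of_tupleIsoAt_generic_of_algClosed` — §2, HEAD: the hypothesis `hgen` of ★ (GS-3) VERBATIM, from `hpieces` and injectivity at the `Ω₀`-points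
  `y` with `y ≫ q = Spec Ω₀ → Spec B` along ONE generic `ι₀`.

## References
* [MumfordFogartyKirwan1994] D. Mumford, J. Fogarty, F. Kirwan, *Geometric Invariant Theory*, 3rd ed. (1994), Ch. 7 §2 Prop. 7.3 (p. 132); §3 Thm. 7.9 (pp. 139–140).
* [GortzWedhorn2020] U. Görtz, T. Wedhorn, *Algebraic Geometry I*, 2nd ed. (2020), Prop. 3.35 and Cor. 3.36 (closed points very dense; Nullstellensatz), Lemma 4.28 (points of fibre products), Def. 9.7 ∕ Prop. 9.8 (p. 231).
* [RapoportSmithlingZhang2020Diagonal] M. Rapoport, B. Smithling, W. Zhang, Compos. Math. 156 (2020), §4.1 Thm. 4.1 (p. 17).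
-/

set_option autoImplicit false

noncomputable section

-- Mathlib's `Over`/pull-back API is stated across semireducible wrappers (as in the ★ `AbelianSchemes/*` files).
set_option backward.isDefEq.respectTransparency false

universe u

open CategoryTheory CategoryTheory.Limits AlgebraicGeometry

/-! ### §1 A property cut out by finite-type pieces: failure over the generic point is witnessed in ONE algebraically closed field -/

namespace Literature.AlgebraicGeometry.Limits

open Literature.AlgebraicGeometry.Motives Literature.AlgebraicGeometry.LaurentSchroer2023

/-- **`¬ Φ` AT THE `Ω₀`-POINTS ALONG `ι₀ : B → Ω₀` ⇒ `¬ Φ` AT EVERY GEOMETRIC POINT WITH THE SAME IMAGE IN `Spec B`.**  `w : W → Spec B` locally of finite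
type; `Φ` a property of geometric points of `W` CUT OUT BY PIECES (`Φ t ↔ t` lifts to one of finitely many finite-type `m_i : I_i → W` — the `hpieces` shape of ★
(o1) `exists_finset_heightOneSpectrum_forall_not_of_pieces`); `Ω₀` algebraically closed with `ι₀ : B → Ω₀`.  If `Φ` fails at every `t : Spec Ω₀ → W` with
`t ≫ w = Spec ι₀`, then `Φ` fails at every geometric point `t : Spec Ω → W` whose image in `Spec B` is the image point of `Spec ι₀`: a witness `t = s ≫ m_i`
makes `I_i ×_B Spec Ω₀` NON-EMPTY (Mathlib `Scheme.Pullback.exists_preimage_pullback`) and locally of finite type over `Ω₀`, so it has an `Ω₀`-point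
(★ `nonempty_algPoints_of_isAlgClosed`, [GortzWedhorn2020] Prop. 3.35 ∕ Cor. 3.36), i.e. an `Ω₀`-valued witness. [cite: GortzWedhorn2020, Proposition 3.35 and Corollary 3.36; Lemma 4.28]
[cite: MumfordFogartyKirwan1994, Ch. 7 §2 Proposition 7.3 (p. 132)] -/
theorem forall_not_of_pieces_of_algClosed {B : Type u} [CommRing B] {W : Scheme.{u}} (w : W ⟶ Spec (CommRingCat.of B)) [LocallyOfFiniteType w]
    (Φ : ∀ ⦃Ω : Type u⦄ [Field Ω] [IsAlgClosed Ω], (Spec (CommRingCat.of Ω) ⟶ W) → Prop)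
    (hpieces : ∃ (n : ℕ) (I : Fin n → Scheme.{u}) (m : ∀ i, I i ⟶ W) (_ : ∀ i, QuasiCompact (m i))
      (_ : ∀ i, LocallyOfFiniteType (m i)),
      ∀ ⦃Ω : Type u⦄ [Field Ω] [IsAlgClosed Ω] (t : Spec (CommRingCat.of Ω) ⟶ W),
        Φ t ↔ ∃ (i : Fin n) (s : Spec (CommRingCat.of Ω) ⟶ I i), s ≫ m i = t)
    (Ω₀ : Type u) [Field Ω₀] [IsAlgClosed Ω₀] (ι₀ : CommRingCat.of B ⟶ CommRingCat.of Ω₀)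
    (hgen₀ : ∀ (t : Spec (CommRingCat.of Ω₀) ⟶ W), t ≫ w = Spec.map ι₀ → ¬ Φ t) :
    ∀ ⦃Ω : Type u⦄ [Field Ω] [IsAlgClosed Ω] (t : Spec (CommRingCat.of Ω) ⟶ W),
      (t ≫ w).base (IsLocalRing.closedPoint Ω) = (Spec.map ι₀).base (IsLocalRing.closedPoint Ω₀) → ¬ Φ t := by
  intro Ω _ _ t ht hΦ
  obtain ⟨n, I, m, hqc, hlft, hI⟩ := hpieces
  obtain ⟨i, s, hs⟩ := (hI t).mp hΦ
  haveI := hlft i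
  -- the point of the piece under `s` lies over the image point of `Spec ι₀`
  have hpt : (m i ≫ w).base (s.base (IsLocalRing.closedPoint Ω)) = (Spec.map ι₀).base (IsLocalRing.closedPoint Ω₀) := by
    rw [← Scheme.Hom.comp_apply, ← Category.assoc, hs]
    exact ht
  obtain ⟨z, -, -⟩ := Scheme.Pullback.exists_preimage_pullback (f := m i ≫ w) (g := Spec.map ι₀) _ _ hpt
  -- the fibre of the piece over `Spec Ω₀ → Spec B`: non-empty, locally of finite type over the algebraically closed `Ω₀` ⇒ an `Ω₀`-point
  let P' : SchemeOver Ω₀ := Over.mk (pullback.snd (m i ≫ w) (Spec.map ι₀))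
  haveI : Nonempty ↥P'.left := ⟨z⟩
  haveI : LocallyOfFiniteType P'.hom := inferInstanceAs (LocallyOfFiniteType (pullback.snd (m i ≫ w) (Spec.map ι₀)))
  obtain ⟨a⟩ := nonempty_algPoints_of_isAlgClosed P'
  -- its underlying morphism `σ : Spec Ω₀ → I_i ×_B Spec Ω₀` is a section of `pr₂`
  let σ : Spec (CommRingCat.of Ω₀) ⟶ pullback (m i ≫ w) (Spec.map ι₀) := a.left
  have ha : σ ≫ pullback.snd (m i ≫ w) (Spec.map ι₀) = 𝟙 (Spec (CommRingCat.of Ω₀)) := by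
    have hw' : σ ≫ pullback.snd (m i ≫ w) (Spec.map ι₀) = Spec.map (CommRingCat.ofHom (algebraMap Ω₀ Ω₀)) := Over.w a
    rw [Algebra.algebraMap_self, CommRingCat.ofHom_id, Spec.map_id] at hw'
    exact hw'
  -- the `Ω₀`-point `σ ≫ pr₁ ≫ m_i` of `W` lies over `ι₀` and satisfies `Φ`
  refine hgen₀ ((σ ≫ pullback.fst (m i ≫ w) (Spec.map ι₀)) ≫ m i) ?_ ((hI _).mpr ⟨i, _, rfl⟩)
  simp only [Category.assoc]
  rw [pullback.condition, ← Category.assoc, ha, Category.id_comp]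

end Literature.AlgebraicGeometry.Limits

/-! ### §2 The hypothesis `hgen` of ★ (GS-3) from one algebraically closed field -/

namespace Literature.AlgebraicGeometry.AbelianSchemes

namespace AbelianSchemeOver

open Literature.AlgebraicGeometry.Limits Literature.AlgebraicGeometry.Motives

/-- **(GS-3c′) GENERIC INJECTIVITY FROM ONE ALGEBRAICALLY CLOSED FIELD.**  ONE tuple `(𝒜, ι, Â, 𝒫, λ, lvl)` over `q : Y → Spec B` (`q` locally of finite type,
separated) with the `Isom`-PIECES of `pr₁^*𝒜, pr₂^*𝒜` over `Y ×_B Y` (`hpieces`, VERBATIM ★ (GS-3) ∕ ★ (b0) `exists_isomPieces_of_atlas`); ONE algebraically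
closed `Ω₀` with a GENERIC `ι₀ : B → Ω₀` (`Spec ι₀` hits the generic point).  If `tupleIsoAt y₁ y₂ 𝒜 …` (UNFOLDED) forces `y₁ = y₂` for all `Ω₀`-points
`y₁, y₂` with `yᵢ ≫ q = Spec ι₀`, then the hypothesis `hgen` of ★ (GS-3) holds VERBATIM (every algebraically closed `Ω`, every pair over the generic point): the
pair point of a counterexample lies in an `Isom`-piece off the diagonal over `η` (★ (R2) rebase, ★ `lift_base_notMem_range_diagonal`), and §1 moves it to `Ω₀`.
[cite: MumfordFogartyKirwan1994, Ch. 7 §2 Proposition 7.3 (p. 132); §3 Theorem 7.9 (pp. 139–140)] [cite: GortzWedhorn2020, Proposition 3.35 and Corollary 3.36; Definition 9.7 and Proposition 9.8 (p. 231)]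
[cite: RapoportSmithlingZhang2020Diagonal, §4.1 Thm. 4.1 p. 17] -/
theorem forall_eq_of_tupleIsoAt_generic_of_algClosed {B : Type u} [CommRing B] [IsDomain B] {Y : Scheme.{u}} (q : Y ⟶ Spec (CommRingCat.of B))
    [LocallyOfFiniteType q] [IsSeparated q]
    (𝒜 : AbelianSchemeOver Y) {O : Type*} [CommRing O] (ρ : RingAction O 𝒜) (D : 𝒜.DualPair) (pol : 𝒜.Polarization D)
    {g N : ℕ} (lvl : 𝒜.LevelStructure g N)
    (hpieces : ∃ (r : ℕ) (I : Fin r → Scheme.{u}) (f : ∀ i, I i ⟶ pullback q q) (_ : ∀ i, QuasiCompact (f i))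
      (_ : ∀ i, LocallyOfFiniteType (f i)),
      ∀ ⦃Ω : Type u⦄ [Field Ω] [IsAlgClosed Ω] (t : Spec (CommRingCat.of Ω) ⟶ pullback q q),
        (∃ (G : ((𝒜.baseChange (pullback.fst q q)).baseChange t).X.left ⟶ ((𝒜.baseChange (pullback.snd q q)).baseChange t).X.left)
            (Ĝ : ((D.baseChange (pullback.fst q q)).baseChange t).hat.X.left ⟶ ((D.baseChange (pullback.snd q q)).baseChange t).hat.X.left),
          ((lvl.baseChange (pullback.fst q q)).baseChange t).IsBaseChangeVia ((lvl.baseChange (pullback.snd q q)).baseChange t)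
              (𝟙 (Spec (CommRingCat.of Ω))) G ∧
          ((D.baseChange (pullback.fst q q)).baseChange t).hat.IsBaseChangeVia ((D.baseChange (pullback.snd q q)).baseChange t).hat
              (𝟙 (Spec (CommRingCat.of Ω))) Ĝ ∧
          (∃ (wG : ((𝒜.baseChange (pullback.fst q q)).baseChange t).X.hom ≫ 𝟙 (Spec (CommRingCat.of Ω)) =
                G ≫ ((𝒜.baseChange (pullback.snd q q)).baseChange t).X.hom)
              (wĜ : ((D.baseChange (pullback.fst q q)).baseChange t).hat.X.hom ≫ 𝟙 (Spec (CommRingCat.of Ω)) =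
                Ĝ ≫ ((D.baseChange (pullback.snd q q)).baseChange t).hat.X.hom),
            Nonempty ((Scheme.Modules.pullback
              (pullback.map ((𝒜.baseChange (pullback.fst q q)).baseChange t).X.hom ((D.baseChange (pullback.fst q q)).baseChange t).hat.X.hom
                ((𝒜.baseChange (pullback.snd q q)).baseChange t).X.hom ((D.baseChange (pullback.snd q q)).baseChange t).hat.X.hom
                G Ĝ (𝟙 (Spec (CommRingCat.of Ω))) wG wĜ)).obj ((D.baseChange (pullback.snd q q)).baseChange t).P ≅
              ((D.baseChange (pullback.fst q q)).baseChange t).P)) ∧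
          ((pol.baseChange (pullback.fst q q)).baseChange t).lam.left ≫ Ĝ = G ≫ ((pol.baseChange (pullback.snd q q)).baseChange t).lam.left ∧
          ∀ a : O, (baseChangeHom ((ρ.baseChange (pullback.fst q q)).i a) t).left ≫ G =
            G ≫ (baseChangeHom ((ρ.baseChange (pullback.snd q q)).i a) t).left) ↔
        ∃ (i : Fin r) (s : Spec (CommRingCat.of Ω) ⟶ I i), s ≫ f i = t)
    (Ω₀ : Type u) [Field Ω₀] [IsAlgClosed Ω₀] (ι₀ : CommRingCat.of B ⟶ CommRingCat.of Ω₀)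
    (hι₀ : (Spec.map ι₀).base (IsLocalRing.closedPoint Ω₀) = (⊥ : PrimeSpectrum B))
    (hgen₀ : ∀ (y₁ y₂ : Spec (CommRingCat.of Ω₀) ⟶ Y), y₁ ≫ q = Spec.map ι₀ → y₂ ≫ q = Spec.map ι₀ →
      (∃ (G : (𝒜.baseChange y₁).X.left ⟶ (𝒜.baseChange y₂).X.left) (Ĝ : (D.baseChange y₁).hat.X.left ⟶ (D.baseChange y₂).hat.X.left),
        (lvl.baseChange y₁).IsBaseChangeVia (lvl.baseChange y₂) (𝟙 (Spec (CommRingCat.of Ω₀))) G ∧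
        (D.baseChange y₁).hat.IsBaseChangeVia (D.baseChange y₂).hat (𝟙 (Spec (CommRingCat.of Ω₀))) Ĝ ∧
        (∃ (wG : (𝒜.baseChange y₁).X.hom ≫ 𝟙 (Spec (CommRingCat.of Ω₀)) = G ≫ (𝒜.baseChange y₂).X.hom)
            (wĜ : (D.baseChange y₁).hat.X.hom ≫ 𝟙 (Spec (CommRingCat.of Ω₀)) = Ĝ ≫ (D.baseChange y₂).hat.X.hom),
          Nonempty ((Scheme.Modules.pullback
            (pullback.map (𝒜.baseChange y₁).X.hom (D.baseChange y₁).hat.X.hom (𝒜.baseChange y₂).X.hom (D.baseChange y₂).hat.X.hom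
              G Ĝ (𝟙 (Spec (CommRingCat.of Ω₀))) wG wĜ)).obj (D.baseChange y₂).P ≅ (D.baseChange y₁).P)) ∧
        (pol.baseChange y₁).lam.left ≫ Ĝ = G ≫ (pol.baseChange y₂).lam.left ∧
        ∀ a : O, (baseChangeHom (ρ.i a) y₁).left ≫ G = G ≫ (baseChangeHom (ρ.i a) y₂).left) → y₁ = y₂) :
    ∀ ⦃Ω : Type u⦄ [Field Ω] [IsAlgClosed Ω] (y₁ y₂ : Spec (CommRingCat.of Ω) ⟶ Y),
      y₁ ≫ q = y₂ ≫ q → (y₁ ≫ q).base (IsLocalRing.closedPoint Ω) = (⊥ : PrimeSpectrum B) →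
      (∃ (G : (𝒜.baseChange y₁).X.left ⟶ (𝒜.baseChange y₂).X.left) (Ĝ : (D.baseChange y₁).hat.X.left ⟶ (D.baseChange y₂).hat.X.left),
        (lvl.baseChange y₁).IsBaseChangeVia (lvl.baseChange y₂) (𝟙 (Spec (CommRingCat.of Ω))) G ∧
        (D.baseChange y₁).hat.IsBaseChangeVia (D.baseChange y₂).hat (𝟙 (Spec (CommRingCat.of Ω))) Ĝ ∧
        (∃ (wG : (𝒜.baseChange y₁).X.hom ≫ 𝟙 (Spec (CommRingCat.of Ω)) = G ≫ (𝒜.baseChange y₂).X.hom)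
            (wĜ : (D.baseChange y₁).hat.X.hom ≫ 𝟙 (Spec (CommRingCat.of Ω)) = Ĝ ≫ (D.baseChange y₂).hat.X.hom),
          Nonempty ((Scheme.Modules.pullback
            (pullback.map (𝒜.baseChange y₁).X.hom (D.baseChange y₁).hat.X.hom (𝒜.baseChange y₂).X.hom (D.baseChange y₂).hat.X.hom
              G Ĝ (𝟙 (Spec (CommRingCat.of Ω))) wG wĜ)).obj (D.baseChange y₂).P ≅ (D.baseChange y₁).P)) ∧
        (pol.baseChange y₁).lam.left ≫ Ĝ = G ≫ (pol.baseChange y₂).lam.left ∧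
        ∀ a : O, (baseChangeHom (ρ.i a) y₁).left ≫ G = G ≫ (baseChangeHom (ρ.i a) y₂).left) → y₁ = y₂ := by
  classical
  -- the open complement `W` of the (closed) diagonal
  have hΔ : IsClosed (Set.range (pullback.diagonal q).base) := (pullback.diagonal q).isClosedEmbedding.isClosed_range
  let W : (pullback q q).Opens := ⟨(Set.range (pullback.diagonal q).base)ᶜ, hΔ.isOpen_compl⟩
  -- the structure map of `W` and the property `Φ`
  let w : (W : Scheme.{u}) ⟶ Spec (CommRingCat.of B) := W.ι ≫ pullback.fst q q ≫ q
  obtain ⟨r, I, f, hqc, hlft, hI⟩ := hpieces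
  let Φ : ∀ ⦃Ω : Type u⦄ [Field Ω] [IsAlgClosed Ω], (Spec (CommRingCat.of Ω) ⟶ (W : Scheme.{u})) → Prop := fun Ω _ _ u =>
    ∃ (G : (𝒜.baseChange ((u ≫ W.ι) ≫ pullback.fst q q)).X.left ⟶ (𝒜.baseChange ((u ≫ W.ι) ≫ pullback.snd q q)).X.left)
      (Ĝ : (D.baseChange ((u ≫ W.ι) ≫ pullback.fst q q)).hat.X.left ⟶ (D.baseChange ((u ≫ W.ι) ≫ pullback.snd q q)).hat.X.left),
      (lvl.baseChange ((u ≫ W.ι) ≫ pullback.fst q q)).IsBaseChangeVia (lvl.baseChange ((u ≫ W.ι) ≫ pullback.snd q q)) (𝟙 _) G ∧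
      (D.baseChange ((u ≫ W.ι) ≫ pullback.fst q q)).hat.IsBaseChangeVia (D.baseChange ((u ≫ W.ι) ≫ pullback.snd q q)).hat (𝟙 _) Ĝ ∧
      (∃ (wG : (𝒜.baseChange ((u ≫ W.ι) ≫ pullback.fst q q)).X.hom ≫ 𝟙 _ = G ≫ (𝒜.baseChange ((u ≫ W.ι) ≫ pullback.snd q q)).X.hom)
          (wĜ : (D.baseChange ((u ≫ W.ι) ≫ pullback.fst q q)).hat.X.hom ≫ 𝟙 _ = Ĝ ≫ (D.baseChange ((u ≫ W.ι) ≫ pullback.snd q q)).hat.X.hom),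
        Nonempty ((Scheme.Modules.pullback
          (pullback.map (𝒜.baseChange ((u ≫ W.ι) ≫ pullback.fst q q)).X.hom (D.baseChange ((u ≫ W.ι) ≫ pullback.fst q q)).hat.X.hom
            (𝒜.baseChange ((u ≫ W.ι) ≫ pullback.snd q q)).X.hom (D.baseChange ((u ≫ W.ι) ≫ pullback.snd q q)).hat.X.hom G Ĝ (𝟙 _) wG wĜ)).obj
            (D.baseChange ((u ≫ W.ι) ≫ pullback.snd q q)).P ≅ (D.baseChange ((u ≫ W.ι) ≫ pullback.fst q q)).P)) ∧
      (pol.baseChange ((u ≫ W.ι) ≫ pullback.fst q q)).lam.left ≫ Ĝ = G ≫ (pol.baseChange ((u ≫ W.ι) ≫ pullback.snd q q)).lam.left ∧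
      ∀ a : O, (baseChangeHom (ρ.i a) ((u ≫ W.ι) ≫ pullback.fst q q)).left ≫ G =
        G ≫ (baseChangeHom (ρ.i a) ((u ≫ W.ι) ≫ pullback.snd q q)).left
  have hP : ∃ (n : ℕ) (I' : Fin n → Scheme.{u}) (m : ∀ i, I' i ⟶ (W : Scheme.{u})) (_ : ∀ i, QuasiCompact (m i))
      (_ : ∀ i, LocallyOfFiniteType (m i)),
      ∀ ⦃Ω : Type u⦄ [Field Ω] [IsAlgClosed Ω] (u : Spec (CommRingCat.of Ω) ⟶ (W : Scheme.{u})),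
        Φ u ↔ ∃ (i : Fin n) (s : Spec (CommRingCat.of Ω) ⟶ I' i), s ≫ m i = u := by
    refine ⟨r, fun i => pullback (f i) W.ι, fun i => pullback.snd (f i) W.ι, fun i => inferInstance, fun i => inferInstance, ?_⟩
    intro Ω _ _ u
    change (∃ G Ĝ, _) ↔ _
    rw [exists_tupleIso_comp_iff_exists_tupleIso₂ 𝒜 ρ D pol lvl (pullback.fst q q) (pullback.snd q q) (u ≫ W.ι), hI (u ≫ W.ι)]
    constructor
    · rintro ⟨i, s, hs⟩
      exact ⟨i, pullback.lift s u hs, pullback.lift_snd _ _ _⟩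
    · rintro ⟨i, s, hs⟩
      exact ⟨i, s ≫ pullback.fst (f i) W.ι, by rw [Category.assoc, pullback.condition, ← Category.assoc, hs]⟩
  -- (GENERIC) at the `Ω₀`-points along `ι₀`: equal legs would put the point ON the diagonal — absurd in `W`
  have hG₀ : ∀ (u : Spec (CommRingCat.of Ω₀) ⟶ (W : Scheme.{u})), u ≫ w = Spec.map ι₀ → ¬ Φ u := by
    intro u hu hΦ
    have hq : ((u ≫ W.ι) ≫ pullback.fst q q) ≫ q = ((u ≫ W.ι) ≫ pullback.snd q q) ≫ q := by
      simp only [Category.assoc, pullback.condition]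
    have hu₁ : ((u ≫ W.ι) ≫ pullback.fst q q) ≫ q = Spec.map ι₀ := by simpa only [w, Category.assoc] using hu
    have hu₂ : ((u ≫ W.ι) ≫ pullback.snd q q) ≫ q = Spec.map ι₀ := by rw [← hq]; exact hu₁
    have heq := hgen₀ _ _ hu₁ hu₂ hΦ
    have hmem := lift_base_mem_range_diagonal_of_eq q _ _ hq heq
    have hlift : pullback.lift ((u ≫ W.ι) ≫ pullback.fst q q) ((u ≫ W.ι) ≫ pullback.snd q q) hq = u ≫ W.ι := by
      apply pullback.hom_ext <;> simp
    rw [hlift, Scheme.Hom.comp_apply, Scheme.Opens.ι_apply] at hmem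
    exact (u.base (IsLocalRing.closedPoint Ω₀)).2 hmem
  -- §1: (GENERIC) at every geometric point of `W` over the generic point
  haveI : LocallyOfFiniteType w := by
    dsimp only [w]
    infer_instance
  have hG := forall_not_of_pieces_of_algClosed w Φ hP Ω₀ ι₀ hG₀
  -- READING: a counterexample over the generic point is a point of `W` over `η = Spec ι₀ (pt)`
  intro Ω _ _ y₁ y₂ hq hη hiso
  by_contra hne
  have hnot := lift_base_notMem_range_diagonal q y₁ y₂ hq hne
  have hrange : Set.range (pullback.lift y₁ y₂ hq).base ⊆ Set.range W.ι.base := by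
    rintro _ ⟨x, rfl⟩
    obtain rfl : x = IsLocalRing.closedPoint Ω := Subsingleton.elim _ _
    exact ⟨⟨_, hnot⟩, rfl⟩
  let u : Spec (CommRingCat.of Ω) ⟶ (W : Scheme.{u}) := IsOpenImmersion.lift W.ι (pullback.lift y₁ y₂ hq) hrange
  have hu : u ≫ W.ι = pullback.lift y₁ y₂ hq := IsOpenImmersion.lift_fac _ _ _
  have h₁ : (u ≫ W.ι) ≫ pullback.fst q q = y₁ := by rw [hu, pullback.lift_fst]
  have h₂ : (u ≫ W.ι) ≫ pullback.snd q q = y₂ := by rw [hu, pullback.lift_snd]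
  refine hG u ?_ ?_
  · -- `u` lies over the generic point `η = Spec ι₀ (pt)`
    have : u ≫ w = y₁ ≫ q := by simp only [w, ← Category.assoc, h₁]
    rw [this, hι₀]
    exact hη
  · -- `Φ u`: transport the isomorphism along `h₁`, `h₂`
    change ∃ G Ĝ, _
    rw [h₁, h₂]
    exact hiso

end AbelianSchemeOver

end Literature.AlgebraicGeometry.AbelianSchemes

end
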